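/-
Origin: expansion seat `planner-pub-hodgecm-pv09-g3-0`, handover (13) 2026-08-18T06:20:55Z (`HOME/pub-hodgecm-pv09-g3/lean/Pv09g3/CharContinuity.lean`, md5 52cd87e2, 154 lines);
landed by the gen-6 packager in gate run 24 as `HodgeCM/PerL34/CharContinuity.lean` (import ^import Pv[0-9]+g[0-9]+\.→import HodgeCM.PerL34. ×1).
-/
/-
Copyright: HodgeCM publication cell (pub-hodgecm), DAG node N31 — seam (I) / S3 (prover pv09, gen 3).
Released under the package licence.

# Continuity of the character `χ′` from its level and LOCAL continuity at the places of the level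

Source under adjudication (NOT cited; this file PROVES a reduction of one hypothesis of the seam):
PerL v5, Lemma 4.2(b) proof, tex ll. 624–628 (`χ′` has a level `K_{T′}`; `χ′_v = 1` on `B_v` off `T′`).

Companion of `OrbitContinuity.lean`: the hypothesis `Continuous χ` of the S3 end theorem is reduced
to the level hypothesis `boxSubgroup B T′ ≤ χ.ker` (EXISTS, pv10) plus continuity of the finitely
many local components `χ ∘ ι_i`, `i ∈ T′`:

* `continuous_localChar_of_not_mem` — off `T′` the local component `g ↦ χ(ι_i g)` is trivial on
  the OPEN subgroup `B_i`, hence continuous (a homomorphism constant near `1`);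
* `continuous_char` — `χ` is continuous on `Πʳ_i [G_i, B_i]` (universal property of the
  restricted-product topology, as in `continuous_orbit`: on each piece `χ(y) = ∏_{i∈F} χ(ι_i y_i)`);
* `theta_ne_zero_levels_of_places` — the end theorem with BOTH `Continuous (y ↦ ω y φ)` and
  `Continuous χ` replaced by local data.

Mathlib + this seat's files only; nothing cited; no hypothesis names PerL, QW8 or a 2001-programme
claim.  Axioms: the standard trio.  Unit `pub-hodgecm-pv09-g3`, 2026-08-18.
-/
import Summits.HodgeConjecture.HodgeCM.PerL34.OrbitContinuity

set_option autoImplicit false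

noncomputable section

open MeasureTheory Filter Topology
open scoped RestrictedProduct InnerProductSpace

namespace HodgeCM.PerL34.PureTensor

open HodgeCM.PerL34.AdelicFactorisation HodgeCM.PerL34.RestrictedMeasure
  HodgeCM.PerL34.NoSmallSubgroups HodgeCM.PerL34.EulerFactorisation


/-! ## §1 Local and global continuity of a character with a level -/

section charCont

variable {ι : Type} {G : ι → Type} [∀ i, CommGroup (G i)] [∀ i, TopologicalSpace (G i)]
  [∀ i, IsTopologicalGroup (G i)] [DecidableEq ι]
  {Sub : ι → Type} [∀ i, SetLike (Sub i) (G i)] [∀ i, SubgroupClass (Sub i) (G i)]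
  (B : ∀ i, Sub i) (hBo : ∀ i, IsOpen (B i : Set (G i)))
  (χ : (Πʳ j, [G j, B j]) →* Circle) {T' : Finset ι}
  (hχT' : RestrictedProduct.boxSubgroup B T' ≤ χ.ker)

include hBo hχT' in
/-- Off the level set `T′`, the local component `g ↦ χ(ι_i g)` is trivial on the open subgroup
`B_i`, hence continuous. -/
theorem continuous_localChar_of_not_mem {i : ι} (hi : i ∉ T') :
    Continuous fun g : G i => χ (RestrictedProduct.mulSingle B i g) := by
  have hcomp : Continuous (χ.comp (inclHom B i)) := by
    refine continuous_of_continuousAt_one (χ.comp (inclHom B i)) ?_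
    have hev : (fun g : G i => χ.comp (inclHom B i) g) =ᶠ[𝓝 1] fun _ => 1 := by
      filter_upwards [(hBo i).mem_nhds (one_mem (B i))] with g hg
      rw [MonoidHom.comp_apply, inclHom_apply]
      exact hχT' (RestrictedProduct.mulSingle_mem_boxSubgroup T' hi hg)
    have h1 : ContinuousAt (fun _ : G i => (1 : Circle)) 1 := continuousAt_const
    have h2 := h1.congr hev.symm
    rwa [ContinuousAt, map_one] at h2 ⊢
  simpa only [MonoidHom.coe_comp, Function.comp_def, inclHom_apply] using hcomp

include hBo hχT' in
/-- **Continuity of a character from its level and local continuity on the level set.** -/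
theorem continuous_char
    (hlocχ : ∀ i ∈ T', Continuous fun g : G i => χ (RestrictedProduct.mulSingle B i g)) :
    Continuous χ := by
  have hall : ∀ i, Continuous fun g : G i => χ (RestrictedProduct.mulSingle B i g) := fun i => by
    by_cases hi : i ∈ T'
    · exact hlocχ i hi
    · exact continuous_localChar_of_not_mem B hBo χ hχT' hi
  rw [RestrictedProduct.continuous_dom]
  intro S hS
  have hfin : Sᶜ.Finite := mem_cofinite.1 (le_principal_iff.1 hS)
  set F : Finset ι := hfin.toFinset ∪ T' with hF
  have hTF : T' ⊆ F := Finset.subset_union_right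
  have key : ∀ x : Πʳ j, [G j, B j]_[𝓟 S],
      χ (RestrictedProduct.inclusion _ _ hS x)
        = ∏ i ∈ F, χ (RestrictedProduct.mulSingle B i (x i)) := by
    intro x
    set a : Πʳ j, [G j, B j] := RestrictedProduct.inclusion _ _ hS x with ha
    have hk : (extendOne B F fun i : ↥F => x (i : ι))⁻¹ * a ∈ RestrictedProduct.boxSubgroup B T' := by
      refine boxSubgroup_antitone B hTF (extendOne_inv_mul_mem_boxSubgroup B F _ a
        (fun i _ => rfl) (fun i hi => ?_))
      have hiS : i ∈ S := by
        by_contra h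
        exact hi (Finset.mem_union_left _ (hfin.mem_toFinset.2 h))
      exact (eventually_principal.1 x.2) i hiS
    have hk1 : χ ((extendOne B F fun i : ↥F => x (i : ι))⁻¹ * a) = 1 := hχT' hk
    calc χ a = χ (extendOne B F (fun i : ↥F => x (i : ι)) *
          ((extendOne B F fun i : ↥F => x (i : ι))⁻¹ * a)) := by rw [mul_inv_cancel_left]
      _ = χ (extendOne B F fun i : ↥F => x (i : ι)) := by rw [map_mul, hk1, mul_one]
      _ = ∏ i ∈ F, χ (RestrictedProduct.mulSingle B i (x i)) := by
          rw [extendOne_eq_prod, map_prod,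
            Finset.prod_coe_sort F fun i => χ (RestrictedProduct.mulSingle B i (x i))]
  have hcont : Continuous fun x : Πʳ j, [G j, B j]_[𝓟 S] =>
      ∏ i ∈ F, χ (RestrictedProduct.mulSingle B i (x i)) :=
    continuous_finsetProd F fun i _ => (hall i).comp (RestrictedProduct.continuous_eval i)
  exact hcont.congr fun x => (key x).symm

end charCont

/-! ## §2 The end theorem of the seam with levels and local continuity only -/

section levels_end

open ComplexConjugate

variable {ι : Type} {G : ι → Type} [∀ i, CommGroup (G i)] [∀ i, TopologicalSpace (G i)]
  [∀ i, IsTopologicalGroup (G i)] [∀ i, T2Space (G i)] [∀ i, SecondCountableTopology (G i)]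
  [∀ i, LocallyCompactSpace (G i)] [∀ i, MeasurableSpace (G i)] [∀ i, BorelSpace (G i)]
  [Countable ι] [DecidableEq ι]
  (B : ∀ i, Subgroup (G i)) (hBc : ∀ i, IsCompact (B i : Set (G i)))
  (hBo : ∀ i, IsOpen (B i : Set (G i))) (S₀ : Finset ι)
  {Sp : Type} [NormedAddCommGroup Sp] [InnerProductSpace ℂ Sp]
  {E : Type*} [NormedAddCommGroup E] [InnerProductSpace ℂ E]
  (ω : (Πʳ j, [G j, B j]) →* (Sp ≃ₗᵢ[ℂ] Sp)) (φ : Sp) (hφ : ‖φ‖ = 1)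
  (hloc : ∀ (i : ι) (v : Sp), Continuous fun g : G i => ω (RestrictedProduct.mulSingle B i g) v)
  (χ : (Πʳ j, [G j, B j]) →* Circle) {T' : Finset ι}
  (hχT' : RestrictedProduct.boxSubgroup B T' ≤ χ.ker)
  (hlocχ : ∀ i ∈ T', Continuous fun g : G i => χ (RestrictedProduct.mulSingle B i g))
  (𝓕 : Set (Πʳ j, [G j, B j])) (h𝓕c : IsCompact 𝓕) (h𝓕i : (interior 𝓕).Nonempty)
  (K : (Πʳ j, [G j, B j]) → (Πʳ j, [G j, B j]) → ℂ) (c : ℝ) (c_pos : 0 < c) (θ : E) (Θ : Set E)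
  (hθ : θ ∈ Θ)
  (hN31e : RallisIP.N31e_statement (haarDatum B hBc hBo S₀).μ 𝓕 ω φ
    (fun y => ((χ y : Circle) : ℂ)) K (c : ℂ))
  (hnorm : ⟪θ, θ⟫_ℂ = ∫ u in 𝓕, ∫ u' in 𝓕, ((χ u : Circle) : ℂ) * conj ((χ u' : Circle) : ℂ) *
    K u u' ∂(haarDatum B hBc hBo S₀).μ ∂(haarDatum B hBc hBo S₀).μ)
  {T : Finset ι} (hK : ∀ k ∈ RestrictedProduct.boxSubgroup B T, ω k φ = φ)
  (hM : ∀ S : Finset ι, T ⊆ S → ∀ y : (i : ↥S) → G i,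
    inner ℂ φ (ω (extendOne B S y) φ) = ∏ i : ↥S, localCoeff B ω φ i (y i))
  {S : Finset ι} {q : ι → ℕ} {chiPi nuPi : ι → ℂ} {IsSplit : ι → Prop}
  (X : UnramifiedPlaceData B (haarDatum B hBc hBo S₀) ω φ χ S q chiPi nuPi IsSplit)
  (hTS : T ⊆ S) (hT'S : T' ⊆ S)
  (hclS : ∀ i ∈ S, Integrable (localCoeff B ω φ i) ((haarDatum B hBc hBo S₀).ν i))
  (ram_pos : ∀ i ∈ S, 0 < (localIntegrand B (haarDatum B hBc hBo S₀) ω φ χ i).I)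

include hφ hloc hχT' hlocχ h𝓕c h𝓕i c_pos hθ hN31e hnorm hK hM X hTS hT'S hclS ram_pos

/-- **Non-vanishing of `θ` — canonical Haar data, compact fundamental domain, levels `K_T`, `K_{T′}`
and LOCAL continuity only**, over the finite places of a number field. -/
theorem theta_ne_zero_levels_of_places (L₀ : Type*) [Field L₀] [NumberField L₀]
    (e : {j : ι // j ∉ S} → IsDedekindDomain.HeightOneSpectrum (NumberField.RingOfIntegers L₀))
    (he : Function.Injective e)
    (hq : ∀ j : {j : ι // j ∉ S}, q j.1 = Ideal.absNorm (e j).asIdeal) : θ ≠ 0 :=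
  theta_ne_zero_local_of_places B hBc hBo S₀ ω φ hφ hloc χ (continuous_char B hBo χ hχT' hlocχ) 𝓕
    h𝓕c h𝓕i K c c_pos θ Θ hθ hN31e hnorm hK hχT' hM X hTS hT'S hclS ram_pos L₀ e he hq

end levels_end

end HodgeCM.PerL34.PureTensor
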